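import Summits.QuantumFields.YangMills.Theses.PencilRigidity
import Summits.QuantumFields.YangMills.Theorems.HypercubicLimit.Negative.ExtendByZero
import Summits.QuantumFields.YangMills.Theorems.HypercubicLimit.Negative.NonabelianLoadBearing
import Summits.QuantumFields.YangMills.Theorems.HypercubicLimit.Negative.AllTimesGapFalse
import Summits.QuantumFields.YangMills.Theorems.LatticeGapOnTrajectory.Negative.ZeroCouplingGap

/-!
# Disproof of `WeakCouplingHypercubicLimit` (crux `stmt-QuantumFields-16120`, route PencilRigidity) —
# standing adversary, cycle 1 — findings

`PencilRigidity.WeakCouplingHypercubicLimit` = "for every compact simple Lie group `G` there are a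
faithful unitary `r`, a Wilson scheme `sch` AT WEAK COUPLING (`β_k → +∞`) and a labelled Schwinger
family `S` on `ℝ⁴` over ALL gauge-invariant lattice observables, in ONE-FIELD GAUGE (every string with
a non-curvature entry vanishes identically), with E0–E4 minus rotations (plus proper-hypercubic
invariance), joint lattice convergence along `sch`, non-triviality and non-Gaussianity of `tr F²`, a
continuum gap and a volume-uniform lattice gap".  It is the re-typed Clay statement `YangMills` minus
`SO(4)`-invariance (§1: `not_yangMills_of_not_weakCouplingHypercubicLimit`), so an unconditional
`¬` would refute the summit statement as typed; none was found.  This file records, as CHECKED Lean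
(rc 0, no `sorry`; §6 is a prose near-miss), what the two clauses NEW in this crux — the
weak-coupling clause `sch.HasWeakCouplingLimit` and the one-field clause — do and do not carry, on top
of the sibling disprover's census for the β-free predecessor `HypercubicLimit` (stmt-8646:
`Theorems/HypercubicLimit/Negative/*`, imported where still sound).

## LANDED from this file (ACCEPTED, `--supports stmt-QuantumFields-16120`; IMPORT these, namespace
## `Summit.QuantumFields.YangMills.Theorems.WeakCouplingHypercubicLimit.Negative`)

* `Theorems/WeakCouplingHypercubicLimit/Negative/SummitTie.lean` (p121291, §1):
  `not_yangMills_of_not_weakCouplingHypercubicLimit`.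
* `Theorems/WeakCouplingHypercubicLimit/Negative/JunkFloor.lean` (p121247, §2): `osBlock_of_osData`,
  `converges_vacuum_of_c_eq_zero`, `oneField_vacuum`, `junkFloor_without_weakCoupling`,
  `junkFloor_false_on_zeroScheme`, `junkFloor_iff_weakCouplingLatticeGap` (clauses quoted verbatim).
* `Theorems/WeakCouplingHypercubicLimit/Negative/LoadBearing.lean` (p121203, §§3–5):
  `weakCouplingHypercubicLimit_false_without_nonabelian`,
  `weakCouplingHypercubicLimit_body_false_with_allTimesGap`,
  `weakCouplingHypercubicLimit_body_false_of_beta_le`.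
This work file keeps its own (def-based, shorter) copies only to stay self-contained and readable.

## Findings (index)

* §0 `weakCouplingHypercubicLimit_iff` — the crux unbundled into `Clauses` (definitional); `Clauses₀` =
  the clause set of the sibling `MirrorModularBoosts.WeakCouplingHypercubicLimit` (stmt-16154, verbatim;
  its route module's farm olean predates the re-type today, so the sibling decl is not named yet).
* §1 **The one-field clause carries no weight; the crux is the summit minus rotations.**
  `clauses_of_clauses₀` (silence every other species: `oneSpeciesScheme`, extend the curvature channel
  by zero — re-done here on the sound `Negative/ExtendByZero`, because the landed
  `Negative/OneFieldReduction.lean` names the dropped `PencilRigidity.HypercubicLimit` and its farm olean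
  is stale), `exists_clauses_iff_exists_clauses₀` (**16120 ⇔ 16154**: one proof or one refutation
  serves both routes), `not_yangMills_of_not_weakCouplingHypercubicLimit` (**any kill of this crux
  refutes `YangMills` as typed**; equivalently the crux is NECESSARY for the summit).
* §2 **What `HasWeakCouplingLimit` is load-bearing against.**  Without it the "junk floor" (all
  clauses except non-triviality/non-Gaussianity) is a THEOREM for every `G`, `r`
  (`junkFloor_without_weakCoupling`: zero scheme + vacuum family, the lattice gap being free at
  `β ≡ 0`); the clause kills exactly that witness (`not_junkClauses_zeroScheme`), and WITH it the junk
  floor is EQUIVALENT to a weak-coupling, volume-uniform lattice mass gap along some scheme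
  (`junkFloor_iff_weakCouplingLatticeGap`: ⇐ by silencing all species over the vacuum family, the
  weak-coupling and lattice-gap clauses being blind to `(c, m)` — `hasWeakCouplingLimit_silence`,
  `hasLatticeMassGap_silence`).  Moral: after the re-type even the contentless part of the crux is
  an open problem (the IR half: `β ≥ β₁ ⇒` uniform lattice gap, cf. ModularSelfDualFold's
  `WeakCouplingLatticeGap`), and the UV half is, as before, `Converges ∧ TwoPointNontrivial`.
* §3 `weakCouplingHypercubicLimit_false_without_nonabelian` — weakening `IsCompactSimpleLieGroup` to
  "connected with a faithful unitary representation" makes the crux FALSE (`G = PUnit`; the sibling's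
  determinism bridge `not_converges_and_twoPointNontrivial_of_subsingleton` applies verbatim: the
  weak-coupling clause does not interact with it).
* §4 `not_gapsAllTimes`, `not_clausesAllTimes` — the natural strengthening of `HasLatticeMassGap`
  dropping `n ≤ S` kills the crux for EVERY compact simple `G` (periodicity of torus correlations vs.
  positive variance of the curvature, sibling's `not_hasLatticeMassGapAllTimes`; β-independent, so it
  survives the re-type).  `0 < Δ` is load-bearing on the lattice side (`hasLatticeMassGap_of_nonpos`,
  imported).
* §5 Small print of the weak-coupling clause: `eventually_beta_pos` (Wilson's lattice measures along a
  witness are eventually at POSITIVE coupling — odd-torus reflection positivity and the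
  `BetaMustLeaveZero` conclusion of the sibling census come for free), `not_clauses_of_beta_le`
  (bounded-β schemes, in particular every fixed-coupling or finite-β-critical "continuum limit", are
  excluded), `hasWeakCouplingLimit_withLinearBeta` (the clause constrains NOTHING else of the scheme
  by itself: any `(a, L, c, m)` can be paired with `β_k = k`; its teeth act only through the Wilson
  measures inside `Converges` and `HasLatticeMassGap`).
* §6 NEAR-MISS (docblock; nothing sorried, nothing landed): the freezing mechanism of `Literature.Barriers.QuantumFields.DiscreteSubgroupFreezing` — is
  CONNECTEDNESS load-bearing?  For a finite gauge group with `β_k → ∞` the lattice theory enters its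
  frozen/Higgs regime where correlations cluster at a β-uniform rate in LATTICE units
  (tree: `abelianHiggs_torus_clustering`, finite abelian); a limit family with E2 has completely
  monotone time correlations (at most exponential decay in PHYSICAL units), so `Converges ∧
  TwoPointNontrivial` should fail — but the witness's free multiplicative renormalisation `c_k` absorbs
  the freezing AMPLITUDE, and the tree's contour bound `|Cov| ≤ C(F₁,F₂) e^{-‖x‖}` does not factor that
  amplitude out.  What is missing is an amplitude-RATIO (equivalently lattice-unit spectral-gap) form
  of the clustering; recorded precisely in §6, not landed.

## Why the crux resists (for ideators / the lead)

* It is implied by `YangMills` (§1), hence not refutable short of refuting Clay's statement as typed;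
  every junk handle of the predecessor census is closed here too (junk `G`: `LatticeRep` forces a
  compact Lie group, PUnit dies on non-triviality §3; junk `S`: every clause reads `S` on `⁰𝒮` or in
  arities `0,1`; junk schemes: `β` bounded is excluded by the new clause, `β ≡ 0` in particular).
* The new clause REMOVES the last free lunch: with `β_k → ∞` the lattice-gap clause is no longer
  witnessed by product Haar measure, so even the vacuum family needs the weak-coupling lattice gap (§2).
  Nothing in the clause ties `β_k` to `a_k` or `L_k` (§5): asymptotic scaling is not encoded, so a
  prover may let `β_k → ∞` as slowly as convenient — but `Converges ∧ TwoPointNontrivial` forces the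
  lattice correlation length at `β_k` to be `≍ 1/a_k` (physical non-triviality), which is the open UV/IR
  problem in both directions (Bałaban stops at UV stability; no IR control at weak coupling).
-/

noncomputable section

open scoped SchwartzMap
open MeasureTheory Filter Topology Complex
open Literature.MathematicalPhysics.AQFT Literature.MathematicalPhysics.QuantumLattice
open Literature.MathematicalPhysics.QuantumFieldTheory
open Summit.QuantumFields.YangMills.Theorems.HypercubicLimit.Negative
open Summit.QuantumFields.YangMills.Theorems.LatticeGapOnTrajectory.Negative

namespace Summit.QuantumFields.YangMills.Cruxes.WeakCouplingHypercubicLimit.Disproof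

/-! ## §0 The crux unbundled -/

section Clauses

variable {ι : Type}

/-- OS clauses E0 (normalisation, hermiticity), E0', E2, E3, E4, translation invariance and
proper-hypercubic invariance on `⁰𝒮` — the OS block of the crux (any label type). -/
def OSClauses (S : LabelledSchwingerFamily ι (EuclideanSpace ℝ (Fin 4))) : Prop :=
  S.IsNormalized ∧ S.IsHermitian ∧ S.HasLinearGrowth ∧ S.IsReflectionPositive ∧ S.IsSymmetric ∧
    S.HasClusterProperty ∧
    (∀ (n : ℕ) (k : Fin n → ι) (a : EuclideanSpace ℝ (Fin 4))
      (F : 𝓢((Fin n → EuclideanSpace ℝ (Fin 4)), ℂ)), IsOffDiagonal F →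
      S n k (translateMulti a F) = S n k F) ∧
    (∀ (n : ℕ) (k : Fin n → ι) (R : EuclideanSpace ℝ (Fin 4) ≃ₗᵢ[ℝ] EuclideanSpace ℝ (Fin 4)),
      LinearMap.det (R.toLinearEquiv : EuclideanSpace ℝ (Fin 4) →ₗ[ℝ] EuclideanSpace ℝ (Fin 4)) = 1 →
      (∀ i : Fin 4, ∃ j : Fin 4, R (EuclideanSpace.single i 1) = EuclideanSpace.single j 1 ∨
        R (EuclideanSpace.single i 1) = -EuclideanSpace.single j 1) →
      ∀ F : 𝓢((Fin n → EuclideanSpace ℝ (Fin 4)), ℂ), IsOffDiagonal F →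
        S n k (linActMulti R F) = S n k F)

/-- Non-triviality of the species `s` — the crux's clause (`OSData.IsNontrivial` unbundled). -/
def TwoPointNontrivial (S : LabelledSchwingerFamily ι (EuclideanSpace ℝ (Fin 4))) (s : ι) : Prop :=
  ∃ (F₁ G₁ : 𝓢((Fin 1 → EuclideanSpace ℝ (Fin 4)), ℂ))
    (H₁ : 𝓢((Fin (1 + 1) → EuclideanSpace ℝ (Fin 4)), ℂ)),
    IsTimeOrdered F₁ ∧ IsTimeOrdered G₁ ∧ IsAppendTensorOf H₁ (osAdjoint F₁) G₁ ∧
      S (1 + 1) (fun _ => s) H₁ ≠ S 1 (fun _ => s) (osAdjoint F₁) * S 1 (fun _ => s) G₁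

/-- Non-Gaussianity of the species `s` — the crux's clause (`OSData.IsNonGaussian` unbundled). -/
def ThreePointNonGaussian (S : LabelledSchwingerFamily ι (EuclideanSpace ℝ (Fin 4))) (s : ι) : Prop :=
  ∃ (f g h : 𝓢(EuclideanSpace ℝ (Fin 4), ℂ)) (Ffgh : 𝓢((Fin 3 → EuclideanSpace ℝ (Fin 4)), ℂ))
    (Fgh Ffh Ffg : 𝓢((Fin 2 → EuclideanSpace ℝ (Fin 4)), ℂ))
    (Ff Fg Fh : 𝓢((Fin 1 → EuclideanSpace ℝ (Fin 4)), ℂ)),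
    IsTensorOf Ffgh ![f, g, h] ∧ IsOffDiagonal Ffgh ∧ IsTensorOf Fgh ![g, h] ∧
    IsTensorOf Ffh ![f, h] ∧ IsTensorOf Ffg ![f, g] ∧ IsTensorOf Ff ![f] ∧ IsTensorOf Fg ![g] ∧
    IsTensorOf Fh ![h] ∧
      S 3 (fun _ => s) Ffgh - S 1 (fun _ => s) Ff * S 2 (fun _ => s) Fgh -
        S 1 (fun _ => s) Fg * S 2 (fun _ => s) Ffh - S 1 (fun _ => s) Fh * S 2 (fun _ => s) Ffg +
        2 * (S 1 (fun _ => s) Ff * S 1 (fun _ => s) Fg * S 1 (fun _ => s) Fh) ≠ 0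

variable {G : Type} [Group G] [TopologicalSpace G] [IsTopologicalGroup G] [CompactSpace G]
  [MeasurableSpace G] [BorelSpace G]

/-- The convergence clause (`IsYangMillsFor` unbundled): joint lattice `n`-point functions of every
species string converge along `sch` on real off-diagonal tensors. -/
def Converges (r : LatticeRep G) (sch : SpeciesScheme (YMSpecies G))
    (S : LabelledSchwingerFamily (YMSpecies G) (EuclideanSpace ℝ (Fin 4))) : Prop :=
  ∀ (n : ℕ), n ≠ 0 → ∀ (σ : Fin n → YMSpecies G) (f : Fin n → 𝓢(EuclideanSpace ℝ (Fin 4), ℝ))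
    (F : 𝓢((Fin n → EuclideanSpace ℝ (Fin 4)), ℂ)),
    IsTensorOf F (fun i => ofRealTest (f i)) → IsOffDiagonal F →
      Tendsto (fun k : ℕ => ((latticeSchwinger r.ρ sch (fun s => s.F) k n σ f : ℝ) : ℂ))
        atTop (𝓝 (S n σ F))

/-- The two gap clauses with a common rate. -/
def Gaps {κ : Type} (r : LatticeRep G) (sch : SpeciesScheme κ)
    (S : LabelledSchwingerFamily ι (EuclideanSpace ℝ (Fin 4))) : Prop :=
  ∃ Δ : ℝ, 0 < Δ ∧ S.HasMassGap Δ ∧ HasLatticeMassGap r sch Δ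

/-- **The one-field clause** (new in this crux): every string with a non-curvature entry vanishes
identically (on ALL test functions). -/
def OneField (r : LatticeRep G)
    (S : LabelledSchwingerFamily (YMSpecies G) (EuclideanSpace ℝ (Fin 4))) : Prop :=
  ∀ (n : ℕ) (k : Fin n → YMSpecies G), (∃ i, k i ≠ r.curvature) →
    ∀ F : 𝓢((Fin n → EuclideanSpace ℝ (Fin 4)), ℂ), S n k F = 0

/-- All clauses of THIS crux for one gauge group and one witness `(r, sch, S)`. -/
def Clauses (r : LatticeRep G) (sch : SpeciesScheme (YMSpecies G))
    (S : LabelledSchwingerFamily (YMSpecies G) (EuclideanSpace ℝ (Fin 4))) : Prop :=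
  sch.HasWeakCouplingLimit ∧ OneField r S ∧ OSClauses S ∧ Converges r sch S ∧
    TwoPointNontrivial S r.curvature ∧ ThreePointNonGaussian S r.curvature ∧ Gaps r sch S

/-- The clauses of the SIBLING crux `MirrorModularBoosts.WeakCouplingHypercubicLimit`
(stmt-QuantumFields-16154): the same without the one-field clause. -/
def Clauses₀ (r : LatticeRep G) (sch : SpeciesScheme (YMSpecies G))
    (S : LabelledSchwingerFamily (YMSpecies G) (EuclideanSpace ℝ (Fin 4))) : Prop :=
  sch.HasWeakCouplingLimit ∧ OSClauses S ∧ Converges r sch S ∧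
    TwoPointNontrivial S r.curvature ∧ ThreePointNonGaussian S r.curvature ∧ Gaps r sch S

/-- The "junk floor" of the crux: every clause except non-triviality and non-Gaussianity. -/
def JunkClauses (r : LatticeRep G) (sch : SpeciesScheme (YMSpecies G))
    (S : LabelledSchwingerFamily (YMSpecies G) (EuclideanSpace ℝ (Fin 4))) : Prop :=
  sch.HasWeakCouplingLimit ∧ OneField r S ∧ OSClauses S ∧ Converges r sch S ∧ Gaps r sch S

/-- Forgetting the one-field clause. -/
theorem clauses₀_of_clauses {r : LatticeRep G} {sch : SpeciesScheme (YMSpecies G)}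
    {S : LabelledSchwingerFamily (YMSpecies G) (EuclideanSpace ℝ (Fin 4))} (h : Clauses r sch S) :
    Clauses₀ r sch S :=
  ⟨h.1, h.2.2⟩

/-- Forgetting the two non-triviality clauses. -/
theorem junkClauses_of_clauses {r : LatticeRep G} {sch : SpeciesScheme (YMSpecies G)}
    {S : LabelledSchwingerFamily (YMSpecies G) (EuclideanSpace ℝ (Fin 4))} (h : Clauses r sch S) :
    JunkClauses r sch S :=
  ⟨h.1, h.2.1, h.2.2.1, h.2.2.2.1, h.2.2.2.2.2.2⟩

end Clauses

/-- **The crux, unbundled** (definitional): every compact simple Lie group admits a witness of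
`Clauses`. -/
theorem weakCouplingHypercubicLimit_iff :
    Summit.QuantumFields.YangMills.Theses.PencilRigidity.WeakCouplingHypercubicLimit ↔
      ∀ (G : Type) [Group G] [TopologicalSpace G] [IsTopologicalGroup G] [CompactSpace G],
        IsCompactSimpleLieGroup G →
          letI : MeasurableSpace G := borel G
          haveI : BorelSpace G := ⟨rfl⟩
          ∃ (r : LatticeRep G) (sch : SpeciesScheme (YMSpecies G))
            (S : LabelledSchwingerFamily (YMSpecies G) (EuclideanSpace ℝ (Fin 4))), Clauses r sch S :=
  Iff.rfl

/- NOTE (cycle 1): `Summit.QuantumFields.YangMills.Theses.MirrorModularBoosts.WeakCouplingHypercubicLimit`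
(stmt-16154) is LITERALLY `∀ G …, IsCompactSimpleLieGroup G → ∃ r sch S, Clauses₀ r sch S` (read off the
route file, rev of 2026-08-16T18:01); the farm olean of that route module predates the re-type at the
time of writing, so the sibling equivalence is stated against `Clauses₀`
(`exists_clauses_iff_exists_clauses₀`) and will be re-pointed at the decl once it builds. -/

/-! ## §1 One-field reduction; the crux is the summit minus rotations -/

section OneField

variable {G : Type} [Group G] [TopologicalSpace G] [IsTopologicalGroup G] [CompactSpace G]
  [MeasurableSpace G] [BorelSpace G]

/-- The scheme keeping the renormalisations of `s₀` and renormalising every other species to `0`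
(same `a, β, L, m`). -/
def oneSpeciesScheme (sch : SpeciesScheme (YMSpecies G)) (s₀ : YMSpecies G) :
    SpeciesScheme (YMSpecies G) :=
  { sch with c := fun s k => by classical exact if s = s₀ then sch.c s k else 0 }

omit [Group G] [TopologicalSpace G] [IsTopologicalGroup G] [CompactSpace G] [BorelSpace G] in
/-- A smeared field with zero multiplicative renormalisation vanishes. -/
theorem smearedLatticeField_c_zero (O : LGConfig 4 G → ℝ)
    (Λ : Finset (Literature.Probability.LatticeModels.Site 4)) (a m : ℝ)
    (f : 𝓢(EuclideanSpace ℝ (Fin 4), ℝ)) (U : LGConfig 4 G) :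
    smearedLatticeField O Λ a 0 m f U = 0 := by
  simp [smearedLatticeField]

/-- With a silenced species in the string the lattice `n`-point function vanishes. -/
theorem latticeSchwinger_oneSpeciesScheme_of_ne (r : LatticeRep G) (sch : SpeciesScheme (YMSpecies G))
    (s₀ : YMSpecies G) (k n : ℕ) (σ : Fin n → YMSpecies G)
    (f : Fin n → 𝓢(EuclideanSpace ℝ (Fin 4), ℝ)) {i₀ : Fin n} (hi₀ : σ i₀ ≠ s₀) :
    latticeSchwinger r.ρ (oneSpeciesScheme sch s₀) (fun s => s.F) k n σ f = 0 := by
  unfold latticeSchwinger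
  have h0 : (oneSpeciesScheme sch s₀).c (σ i₀) k = 0 := by simp [oneSpeciesScheme, hi₀]
  have : ∀ U : GaugeConfig 4 ((oneSpeciesScheme sch s₀).side k) G,
      ∏ i, smearedLatticeField ((fun s : YMSpecies G => s.F) (σ i))
        (Literature.Probability.LatticeModels.box 4 ((oneSpeciesScheme sch s₀).L k))
        ((oneSpeciesScheme sch s₀).a k) ((oneSpeciesScheme sch s₀).c (σ i) k)
        ((oneSpeciesScheme sch s₀).m (σ i) k) (f i)
        (torusLift ((oneSpeciesScheme sch s₀).side k) U) = 0 := fun U =>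
    Finset.prod_eq_zero (Finset.mem_univ i₀) (by rw [h0, smearedLatticeField_c_zero])
  simp_rw [this, integral_zero]

/-- On the distinguished species the modified scheme has the original lattice functions. -/
theorem latticeSchwinger_oneSpeciesScheme_self (r : LatticeRep G) (sch : SpeciesScheme (YMSpecies G))
    (s₀ : YMSpecies G) (k n : ℕ) (f : Fin n → 𝓢(EuclideanSpace ℝ (Fin 4), ℝ)) :
    latticeSchwinger r.ρ (oneSpeciesScheme sch s₀) (fun s => s.F) k n (fun _ => s₀) f =
      latticeSchwinger r.ρ sch (fun s => s.F) k n (fun _ => s₀) f := by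
  have hc : (oneSpeciesScheme sch s₀).c s₀ k = sch.c s₀ k := by simp [oneSpeciesScheme]
  unfold latticeSchwinger
  simp_rw [hc]
  rfl

omit [TopologicalSpace G] [IsTopologicalGroup G] [CompactSpace G] [BorelSpace G] in
/-- The weak-coupling clause does not read the renormalisations. -/
theorem hasWeakCouplingLimit_oneSpeciesScheme (sch : SpeciesScheme (YMSpecies G)) (s₀ : YMSpecies G) :
    (oneSpeciesScheme sch s₀).HasWeakCouplingLimit ↔ sch.HasWeakCouplingLimit :=
  Iff.rfl

/-- Nor does the lattice-gap clause. -/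
theorem hasLatticeMassGap_oneSpeciesScheme (r : LatticeRep G) (sch : SpeciesScheme (YMSpecies G))
    (s₀ : YMSpecies G) (Δ : ℝ) :
    HasLatticeMassGap r (oneSpeciesScheme sch s₀) Δ ↔ HasLatticeMassGap r sch Δ :=
  Iff.rfl

/-- **One-field reduction of a witness.**  From a witness `(r, sch, S)` of the sibling's clauses
`Clauses₀` (no one-field clause): silence every species other than the curvature
(`oneSpeciesScheme`, same `β`) and replace `S` by the extension by zero of its curvature channel;
EVERY clause survives and the one-field clause holds.  (The sibling disprover's `clauses_of_clauses₁`
over `Negative/ExtendByZero`, re-assembled for the re-typed clauses: the weak-coupling clause is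
untouched because `β` is.) -/
theorem clauses_of_clauses₀ {r : LatticeRep G} {sch : SpeciesScheme (YMSpecies G)}
    {S : LabelledSchwingerFamily (YMSpecies G) (EuclideanSpace ℝ (Fin 4))} (h : Clauses₀ r sch S) :
    Clauses r (oneSpeciesScheme sch r.curvature)
      (extendByZero r.curvature (restrictTo r.curvature S)) := by
  obtain ⟨hweak, hos, hconv, hnt, hng, Δ, hΔ, hgap, hlat⟩ := h
  refine ⟨hweak, ?_, osClauses_extendByZero (osClauses_restrictTo _ hos), ?_, ?_, ?_, Δ, hΔ,
    hasMassGap_extendByZero (hasMassGap_restrictTo _ hgap), hlat⟩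
  · rintro n k ⟨i, hi⟩ F
    rw [extendByZero_of_not_all _ _ (fun hall => hi (hall i))]
    rfl
  · intro n hn σ f F hF hod
    by_cases hσ : ∀ i, σ i = r.curvature
    · obtain rfl : σ = fun _ => r.curvature := funext hσ
      rw [extendByZero_const]
      simp_rw [latticeSchwinger_oneSpeciesScheme_self]
      exact hconv n hn _ f F hF hod
    · push Not at hσ
      obtain ⟨i₀, hi₀⟩ := hσ
      rw [extendByZero_of_not_all _ _ (fun hall => hi₀ (hall i₀))]
      simp_rw [latticeSchwinger_oneSpeciesScheme_of_ne r sch r.curvature _ n σ f hi₀]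
      simp
  · unfold TwoPointNontrivial at hnt ⊢
    simpa [restrictTo] using hnt
  · unfold ThreePointNonGaussian at hng ⊢
    simpa [restrictTo] using hng

/-- **This crux ⇔ its sibling's clause set** (`Clauses₀` = the clauses of
`MirrorModularBoosts.WeakCouplingHypercubicLimit`, stmt-16154, verbatim): the one-field clause is
free — one proof, or one refutation, serves both routes. -/
theorem exists_clauses_iff_exists_clauses₀ :
    Summit.QuantumFields.YangMills.Theses.PencilRigidity.WeakCouplingHypercubicLimit ↔
      ∀ (G : Type) [Group G] [TopologicalSpace G] [IsTopologicalGroup G] [CompactSpace G],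
        IsCompactSimpleLieGroup G →
          letI : MeasurableSpace G := borel G
          haveI : BorelSpace G := ⟨rfl⟩
          ∃ (r : LatticeRep G) (sch : SpeciesScheme (YMSpecies G))
            (S : LabelledSchwingerFamily (YMSpecies G) (EuclideanSpace ℝ (Fin 4))), Clauses₀ r sch S := by
  refine ⟨fun h G _ _ _ _ hG => ?_, fun h G _ _ _ _ hG => ?_⟩
  · letI : MeasurableSpace G := borel G
    haveI : BorelSpace G := ⟨rfl⟩
    obtain ⟨r, sch, S, hS⟩ := h G hG
    exact ⟨r, sch, S, clauses₀_of_clauses hS⟩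
  · letI : MeasurableSpace G := borel G
    haveI : BorelSpace G := ⟨rfl⟩
    obtain ⟨r, sch, S, hS⟩ := h G hG
    exact ⟨r, _, _, clauses_of_clauses₀ hS⟩

/-- The OS block of genuine OS data (E1 ⊇ translations + proper signed permutations). -/
theorem osClauses_of_osData {ι : Type} (T : OSData ι 4) : OSClauses T.schwinger :=
  ⟨T.normalized, T.hermitian, T.linearGrowth, T.reflectionPositive, T.symmetric, T.cluster,
    T.invariant.1, fun n k R hdet _ F hF => T.invariant.2 n k R hdet F hF⟩

/-- A summit witness is a witness of the sibling's clauses (forget `SO(4)`). -/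
theorem clauses₀_of_summit {r : LatticeRep G} {sch : SpeciesScheme (YMSpecies G)}
    {T : OSData (YMSpecies G) 4}
    (h : sch.HasWeakCouplingLimit ∧ IsYangMillsFor r sch T ∧ T.IsNontrivial r.curvature ∧
      T.IsNonGaussian r.curvature ∧ ∃ Δ > 0, T.HasMassGap Δ ∧ HasLatticeMassGap r sch Δ) :
    Clauses₀ r sch T.schwinger := by
  obtain ⟨hweak, hconv, hnt, hng, Δ, hΔ, hgap, hlat⟩ := h
  exact ⟨hweak, osClauses_of_osData T, hconv, hnt, hng, Δ, hΔ, hgap, hlat⟩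

/-- **Any kill of this crux refutes the summit statement `YangMills` as typed** (the crux is the
re-typed `YangMills` minus the rotation half of E1, in one-field gauge).  Recorded as the reason no
unconditional `¬` is to be expected from junk: a disproof here is a disproof of Clay's statement in
the tree's rendering. -/
theorem not_yangMills_of_not_weakCouplingHypercubicLimit
    (h : ¬ Summit.QuantumFields.YangMills.Theses.PencilRigidity.WeakCouplingHypercubicLimit) :
    ¬ YangMills := by
  intro hYM
  refine h fun G _ _ _ _ hG => ?_
  letI : MeasurableSpace G := borel G
  haveI : BorelSpace G := ⟨rfl⟩
  obtain ⟨r, sch, T, hT⟩ := hYM G hG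
  exact ⟨r, _, _, clauses_of_clauses₀ (clauses₀_of_summit hT)⟩

end OneField

/-! ## §2 What the weak-coupling clause is load-bearing against: the junk floor -/

section JunkFloor

variable {ι : Type} {G : Type} [Group G] [TopologicalSpace G] [IsTopologicalGroup G] [CompactSpace G]
  [MeasurableSpace G] [BorelSpace G]

/-- The scheme with every species silenced (`c = m ≡ 0`, same `a, β, L`). -/
def silence (sch : SpeciesScheme ι) : SpeciesScheme ι :=
  { sch with c := fun _ _ => 0, m := fun _ _ => 0 }

/-- The weak-coupling clause is blind to `(c, m)`. -/
theorem hasWeakCouplingLimit_silence (sch : SpeciesScheme ι) :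
    (silence sch).HasWeakCouplingLimit ↔ sch.HasWeakCouplingLimit :=
  Iff.rfl

/-- The lattice-gap clause is blind to `(c, m)`. -/
theorem hasLatticeMassGap_silence (r : LatticeRep G) (sch : SpeciesScheme ι) (Δ : ℝ) :
    HasLatticeMassGap r (silence sch) Δ ↔ HasLatticeMassGap r sch Δ :=
  Iff.rfl

/-- Along a silenced scheme every lattice `n`-point function with `n ≥ 1` vanishes. -/
theorem latticeSchwinger_silence {N : ℕ} (ρ : G →* Matrix (Fin N) (Fin N) ℂ) (sch : SpeciesScheme ι)
    (obs : ι → LGConfig 4 G → ℝ) (k : ℕ) {n : ℕ} (hn : n ≠ 0) (σ : Fin n → ι)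
    (f : Fin n → 𝓢(EuclideanSpace ℝ (Fin 4), ℝ)) :
    latticeSchwinger ρ (silence sch) obs k n σ f = 0 := by
  obtain ⟨j, rfl⟩ := Nat.exists_eq_succ_of_ne_zero hn
  simp [latticeSchwinger, silence, smearedLatticeField]

/-- The vacuum family converges along every silenced scheme. -/
theorem converges_vacuum_silence (r : LatticeRep G) (sch : SpeciesScheme (YMSpecies G)) :
    Converges r (silence sch) (OSData.vacuum (YMSpecies G) 4).schwinger := by
  intro n hn σ f F _ _
  have hS : (OSData.vacuum (YMSpecies G) 4).schwinger n σ F = 0 := by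
    simp [OSData.vacuum, LabelledSchwingerFamily.trivial_of_ne_zero (YMSpecies G) hn]
  rw [hS]
  refine tendsto_const_nhds.congr' (Eventually.of_forall fun k => ?_)
  dsimp only
  rw [latticeSchwinger_silence r.ρ sch _ k hn]
  simp

/-- The vacuum family is in one-field gauge (indeed in zero-field gauge). -/
theorem oneField_vacuum (r : LatticeRep G) : OneField r (OSData.vacuum (YMSpecies G) 4).schwinger := by
  rintro n k ⟨i, -⟩ F
  have hn : n ≠ 0 := by rintro rfl; exact i.elim0
  simp [OSData.vacuum, LabelledSchwingerFamily.trivial_of_ne_zero (YMSpecies G) hn]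

/-- **Junk witness of the junk floor, given the weak-coupling lattice gap.**  If a scheme at weak
coupling has the volume-uniform lattice gap, silencing all species over the vacuum family witnesses
every clause of the crux except non-triviality / non-Gaussianity. -/
theorem junkClauses_vacuum_silence (r : LatticeRep G) {sch : SpeciesScheme (YMSpecies G)}
    (hweak : sch.HasWeakCouplingLimit) {Δ : ℝ} (hΔ : 0 < Δ) (hlat : HasLatticeMassGap r sch Δ) :
    JunkClauses r (silence sch) (OSData.vacuum (YMSpecies G) 4).schwinger :=
  ⟨hweak, oneField_vacuum r, osClauses_of_osData _, converges_vacuum_silence r sch, Δ, hΔ,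
    OSData.vacuum_hasMassGap Δ, hlat⟩

/-- **The junk floor of the crux ⇔ a weak-coupling lattice mass gap along some scheme.**  With the
weak-coupling clause, "all clauses except non-triviality and non-Gaussianity" holds for `G` iff some
faithful `r` and some scheme with `β_k → ∞` have the volume-uniform lattice gap `HasLatticeMassGap`
(the IR half of the problem — at `β_k → ∞` no longer free).  The two non-triviality clauses are the
entire remaining (UV) obstruction. -/
theorem junkFloor_iff_weakCouplingLatticeGap :
    (∃ (r : LatticeRep G) (sch : SpeciesScheme (YMSpecies G))
        (S : LabelledSchwingerFamily (YMSpecies G) (EuclideanSpace ℝ (Fin 4))), JunkClauses r sch S) ↔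
      ∃ (r : LatticeRep G) (sch : SpeciesScheme (YMSpecies G)),
        sch.HasWeakCouplingLimit ∧ ∃ Δ : ℝ, 0 < Δ ∧ HasLatticeMassGap r sch Δ := by
  constructor
  · rintro ⟨r, sch, S, hweak, -, -, -, Δ, hΔ, -, hlat⟩
    exact ⟨r, sch, hweak, Δ, hΔ, hlat⟩
  · rintro ⟨r, sch, hweak, Δ, hΔ, hlat⟩
    exact ⟨r, silence sch, _, junkClauses_vacuum_silence r hweak hΔ hlat⟩

/-- **Without the weak-coupling clause the junk floor is a theorem** (every `G` with a lattice
representation, every `r`): the zero scheme (`β ≡ 0`: product Haar measure, exact decorrelation) and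
the vacuum family.  This is what `HasWeakCouplingLimit` was added against (statement re-type
2026-08-16). -/
theorem junkFloor_without_weakCoupling (r : LatticeRep G) :
    ∃ (sch : SpeciesScheme (YMSpecies G))
      (S : LabelledSchwingerFamily (YMSpecies G) (EuclideanSpace ℝ (Fin 4))),
      OneField r S ∧ OSClauses S ∧ Converges r sch S ∧ Gaps r sch S := by
  refine ⟨SpeciesScheme.zero _, (OSData.vacuum (YMSpecies G) 4).schwinger, oneField_vacuum r,
    osClauses_of_osData _, isYangMillsFor_vacuum r, 1, one_pos, OSData.vacuum_hasMassGap 1,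
    hasLatticeMassGap_of_zero_coupling r _ (fun _ => rfl) 1⟩

/-- …and the weak-coupling clause alone kills that witness: no family whatsoever rides the zero
scheme. -/
theorem not_junkClauses_zeroScheme (r : LatticeRep G)
    (S : LabelledSchwingerFamily (YMSpecies G) (EuclideanSpace ℝ (Fin 4))) :
    ¬ JunkClauses r (SpeciesScheme.zero _) S :=
  fun h => SpeciesScheme.not_hasWeakCouplingLimit_zero h.1

end JunkFloor

/-! ## §3 Non-abelianness is load-bearing (PUnit), unchanged by the weak-coupling clause -/

section Nonabelian

/-- **The crux is FALSE without "non-abelian"**: weakening `IsCompactSimpleLieGroup G` to "compact,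
connected, with a faithful continuous unitary representation" makes it false — `G = PUnit` has all of
that, every lattice `n`-point function is a product of one-point functions, so `Converges` forces the
two-point function to factorise on real off-diagonal tensors and the sibling's bridge kills
`TwoPointNontrivial`.  The clauses `HasWeakCouplingLimit`, `OneField`, the OS block and the gaps play
no role: any proof must use non-commutativity of `G`, and it enters only through non-triviality. -/
theorem weakCouplingHypercubicLimit_false_without_nonabelian :
    ¬ (∀ (G : Type) [Group G] [TopologicalSpace G] [IsTopologicalGroup G] [CompactSpace G],
        ConnectedSpace G → Nonempty (LatticeRep G) →
          letI : MeasurableSpace G := borel G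
          haveI : BorelSpace G := ⟨rfl⟩
          ∃ (r : LatticeRep G) (sch : SpeciesScheme (YMSpecies G))
            (S : LabelledSchwingerFamily (YMSpecies G) (EuclideanSpace ℝ (Fin 4))), Clauses r sch S) := by
  intro h
  letI : MeasurableSpace PUnit := borel PUnit
  haveI : BorelSpace PUnit := ⟨rfl⟩
  obtain ⟨r, sch, S, -, -, -, hconv, hnt, -⟩ := h PUnit inferInstance ⟨punitRep⟩
  exact not_converges_and_twoPointNontrivial_of_subsingleton r sch S hconv hnt

end Nonabelian

/-! ## §4 The all-times strengthening of the lattice gap kills the crux; `0 < Δ` is load-bearing -/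

section AllTimes

variable {ι : Type} {G : Type} [Group G] [TopologicalSpace G] [IsTopologicalGroup G] [CompactSpace G]
  [MeasurableSpace G] [BorelSpace G]

/-- The gap clauses with `HasLatticeMassGap` strengthened by dropping the restriction `n ≤ S` on the
time separation (all separations on each torus). -/
def GapsAllTimes {κ : Type} (r : LatticeRep G) (sch : SpeciesScheme κ)
    (S : LabelledSchwingerFamily ι (EuclideanSpace ℝ (Fin 4))) : Prop :=
  ∃ Δ : ℝ, 0 < Δ ∧ S.HasMassGap Δ ∧
    ∀ A B : YMSpecies G, ∃ C : ℝ, ∀ᶠ k in atTop, ∀ S' : ℕ, sch.L k ≤ S' → ∀ n : ℕ,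
      |latticeConnectedCorr r.ρ (sch.β k) (2 * S' + 1) A.F B.F n| ≤
        C * Real.exp (-(Δ * (sch.a k * n)))

/-- **The all-times strengthening is unsatisfiable for every non-abelian compact `G`** (every `r`,
every scheme — weak coupling or not — every family): torus time-correlations are periodic, so the
strengthened bound forces every connected correlation (every variance) to vanish eventually, while
the curvature has positive variance under every Wilson measure (sibling's
`not_hasLatticeMassGapAllTimes`).  The restriction `n ≤ S` in `HasLatticeMassGap` is essential. -/
theorem not_gapsAllTimes {κ : Type} (hG : ∃ a b : G, a * b ≠ b * a) (r : LatticeRep G)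
    (sch : SpeciesScheme κ) (S : LabelledSchwingerFamily ι (EuclideanSpace ℝ (Fin 4))) :
    ¬ GapsAllTimes r sch S := by
  rintro ⟨Δ, hΔ, -, h⟩
  exact not_hasLatticeMassGapAllTimes hG r sch hΔ h

/-- Hence the crux with `Gaps` replaced by `GapsAllTimes` is FALSE for every compact simple Lie group
(indeed for every non-abelian compact `G`). -/
theorem not_clausesAllTimes (hG : IsCompactSimpleLieGroup G) (r : LatticeRep G)
    (sch : SpeciesScheme (YMSpecies G))
    (S : LabelledSchwingerFamily (YMSpecies G) (EuclideanSpace ℝ (Fin 4))) :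
    ¬ (sch.HasWeakCouplingLimit ∧ OneField r S ∧ OSClauses S ∧ Converges r sch S ∧
        TwoPointNontrivial S r.curvature ∧ ThreePointNonGaussian S r.curvature ∧ GapsAllTimes r sch S) :=
  fun h => not_gapsAllTimes hG.1.2.1 r sch S h.2.2.2.2.2.2

/-- `0 < Δ` is load-bearing on the lattice side: for `Δ ≤ 0` the lattice clause holds along EVERY
scheme (sibling's `hasLatticeMassGap_of_nonpos`, β-independent). -/
theorem hasLatticeMassGap_of_nonpos' (r : LatticeRep G) (sch : SpeciesScheme ι) {Δ : ℝ} (hΔ : Δ ≤ 0) :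
    HasLatticeMassGap r sch Δ :=
  hasLatticeMassGap_of_nonpos r sch hΔ

end AllTimes

/-! ## §5 Small print of the weak-coupling clause -/

section WeakCoupling

variable {ι : Type} {G : Type} [Group G] [TopologicalSpace G] [IsTopologicalGroup G] [CompactSpace G]
  [MeasurableSpace G] [BorelSpace G]

/-- Along a weak-coupling scheme the Wilson measures are eventually at POSITIVE coupling (so odd-torus
reflection positivity of Wilson's action is available for all large `k`, and the sibling census'
"`β` must leave `0`" is automatic). -/
theorem eventually_beta_pos {sch : SpeciesScheme ι} (h : sch.HasWeakCouplingLimit) :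
    ∀ᶠ k in atTop, 0 < sch.β k :=
  h.eventually_gt_atTop 0

/-- More generally the coupling eventually exceeds any threshold (e.g. a freezing / Higgs threshold
`β_f`, a cluster-expansion threshold, a bulk-transition coupling): finite-`β` lattice artefacts are
invisible to the crux, whose clauses are all tail properties in `k`. -/
theorem eventually_beta_gt {sch : SpeciesScheme ι} (h : sch.HasWeakCouplingLimit) (b : ℝ) :
    ∀ᶠ k in atTop, b < sch.β k :=
  h.eventually_gt_atTop b

/-- **Bounded-`β` schemes are excluded**: no family rides a scheme whose inverse coupling is bounded
above (fixed coupling, strong coupling, or a finite-`β` critical point of Wilson's lattice theory). -/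
theorem not_clauses_of_beta_le {r : LatticeRep G} {sch : SpeciesScheme (YMSpecies G)}
    {S : LabelledSchwingerFamily (YMSpecies G) (EuclideanSpace ℝ (Fin 4))} {B : ℝ}
    (hB : ∀ k, sch.β k ≤ B) : ¬ Clauses r sch S :=
  fun h => SpeciesScheme.not_hasWeakCouplingLimit_of_le sch hB h.1

/-- The scheme with the couplings replaced by `β_k = k` (same `a, L, c, m`). -/
def withLinearBeta (sch : SpeciesScheme ι) : SpeciesScheme ι :=
  { sch with β := fun k => k }

/-- **The weak-coupling clause constrains nothing else of the scheme by itself**: ANY spacings,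
volumes and renormalisations can be paired with `β_k = k → ∞`.  Its teeth act only through the Wilson
measures inside `Converges` and `HasLatticeMassGap` (no asymptotic-scaling profile tying `β_k` to
`a_k` is encoded — recorded open strengthening in `YangMillsOS`). -/
theorem hasWeakCouplingLimit_withLinearBeta (sch : SpeciesScheme ι) :
    (withLinearBeta sch).HasWeakCouplingLimit :=
  tendsto_natCast_atTop_atTop

/-- …while `withLinearBeta` keeps `a`, `L`, `c`, `m` (definitional). -/
theorem withLinearBeta_a (sch : SpeciesScheme ι) : (withLinearBeta sch).a = sch.a := rfl

end WeakCoupling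

/-! ## §6 NEAR-MISS: is connectedness load-bearing?  The freezing mechanism for finite gauge groups

**Claim (not proved here).**  For a FINITE non-trivial gauge group `G` (discrete topology; e.g.
`ℤ₂ ⊂ U(1)`, or the binary icosahedral subgroup of `SU(2)`, which satisfies every clause of
`IsSimpleCompactGroup` except `ConnectedSpace`) and every faithful unitary `r`, NO `(sch, S)` satisfies
`sch.HasWeakCouplingLimit ∧ OSClauses S ∧ Converges r sch S ∧ TwoPointNontrivial S r.curvature`.
This would make CONNECTEDNESS load-bearing for THIS crux by a mechanism specific to the weak-coupling
clause (the β-free predecessor allowed `β_k → β_c(G)` of the finite group).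

**Mechanism.**  `β_k → ∞` drives the finite-group lattice theory into its frozen (Higgs) regime
`β > β_f(G, r)` (`Literature.Barriers.QuantumFields.DiscreteSubgroupFreezing`; action gap
`actionGap_pos_of_finite`), where connected correlations of gauge-invariant local observables cluster
at a rate `m ≥ 1` in LATTICE units, uniformly in `β` and in the volume (tree, finite ABELIAN `G`:
`abelianHiggs_torus_clustering`, re-assembled with β-uniform constants by the sibling disprover of
`TunedSequenceExists` as `abelianHiggs_torus_clustering_explicit`).  On the other hand a limit family
with E2 + time translations has completely monotone truncated time correlations
`φ_v(T) = 𝔖₂ᵀ(θv ⊗ τ_T v) = ∫ e^{-TE} dν_v(E)` (tree `OSReconstructionNoE1`), which decay AT MOST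
exponentially in physical time (`φ_v(T) ≥ φ_v(0)^{1-T/t} φ_v(t)^{T/t}`, Jensen).  Lattice-unit rate
`m` means physical rate `m / a_k → ∞`: the two are incompatible as soon as one truncated value is
non-zero — PROVIDED the lattice bound controls RATIOS of correlations at different separations at the
same `k`.

**Why it is not closed — two independent obstructions (refined, cycle 1).**

(O1) *A LOWER bound is needed, not a better upper bound.*  The witness owns a free multiplicative
renormalisation `c_k`; every clause reads the lattice only through `c_kⁿ ×` (truncated correlations of
smeared fields), and `Converges` pins `c_k² Cov_k(Φ(u), Φ(v)) → T(u ⊗ v)` on off-diagonal real pairs.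
Freezing bounds are UPPER bounds: the tree's contour expansion gives, on the scheme's tori and with
β-uniform constants, `|Cov_k(P_x, P_y)| ≤ K e^{-τ_k(‖x-y‖_∞ - 1)} + (Peierls error)` for the plaquette /
curvature observables (`abelianHiggs_torus_clustering_explicit`; NOTE the tree's `KPRegime d A φ ε τ`
admits `τ = βδ/2 - O(1)` because its smallness condition is `|A| ε e^{1+τ} ≲ 1` with `ε = e^{-βδ}` — so a
rate GROWING linearly in `β` (Adhikari–Cao's `βΔ_G/2`) is available by re-running that assembly with
`τ_k = β_k δ/2 - O(1)` instead of `τ = 1`).  Smearing over supports at physical time-separation `s ≥ 0`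
(lattice separation `≥ max(2, s/a_k)` for half-space pairs) yields
`c_k² |Cov_k| ≤ c_k² K' e^{-τ_k (max(2, s/a_k) - 1)}`, and NOTHING bounds `c_k²` from above: an upper
bound on `c_k` is a LOWER bound on one lattice truncated correlation.  The non-triviality pair `(u₀, v₀)`
(bridge `twoPointNontrivial_iff_real`, landed) gives `c_k² = (T₀ + o(1)) / Cov_k(Φu₀, Φv₀)`, so the
kill is EXACTLY the ratio statement `Cov_k(far pair) / Cov_k(Φu₀, Φv₀) → 0`, i.e. a lower bound
`|Cov_k(Φu₀, Φv₀)| ≥ ε_k^{M}` (`ε_k = e^{-β_k δ}`, `M` fixed) for ONE near pair — a signed double sum of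
plaquette covariances.  Finite energy (DLR, tree `TorusWilsonGibbs`) gives `Var(P_p) ≥ c ε^{6}` for a
single plaquette but no lower bound on signed smeared sums; for `ℤ₂` Griffiths' second inequality
(ferromagnetic plaquette Ising system; the tree's `griffiths_second` is for scalar site potentials, not
gauge plaquette couplings) would make all plaquette covariances `≥ 0`, reducing the task — after a
sign/density reduction of the witness pair to non-negative compactly supported test functions, which
needs continuity of `u ⊗ v ↦ tensor` and `C_c^∞`-density with support control in `𝓢` — to ONE
two-plaquette lower bound `Cov_β(P_x, P_y) ≥ c ε^{M}` at bounded lattice distance, uniformly in the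
volume.  None of these three pieces is in the tree.

(O2) *The reflection defect of the curvature (sibling census §11) blocks the spectral shortcut.*  The
textbook way to turn clustering-with-constants into a RATIO bound is reflection positivity: moments
`n ↦ ⟨Â, Tⁿ Â⟩` are log-convex, so clustering at all shifts forces the spectral measure of `Â` into
`[0, e^{-τ}]`, whence `|⟨Â, Tⁿ B̂⟩| ≤ e^{-τ n} ‖Â‖_OS ‖B̂‖_OS` and, with `n ≥ 1` between the lattice
supports of a half-space pair, `c_k² |Cov_k(Φu₀, Φv₀)| ≤ e^{-τ_k} (c_k‖·‖_OS)(c_k‖·‖_OS) → 0` PROVIDED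
`c_k ‖Φ_k(w)^‖_OS` stays bounded.  But `‖Φ_k(w)^‖²_OS = Cov_k(Θ[Φ_k(w)], Φ_k(w))` and NO lattice time
reflection maps the smeared curvature to a smeared curvature: `Θ[P](θx) = P̃ = P - ∇₀⁻E` (temporal
plaquettes hang down), so `Θ[Φ_P(w)] = Φ_P(θw) - a_k · c_k Φ_E(∂₀-difference of w)` involves the
temporal-plaquette species `E` with the CURVATURE's renormalisation `c_k` and one lattice derivative —
a quantity no clause controls (`E`'s own `c_E` is witness data, silenced in one-field gauge).  The
`L²` (variance) form of a spectral gap avoids reflections but fails dimensionally: `c_k² Var_k(Φ(w))`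
is a COINCIDENT-point quantity and diverges (`Converges` speaks of off-diagonal pairs only).

Upshot for the record: CONNECTEDNESS is certainly used by any proof (a finite `G` freezes at the
couplings the clause `HasWeakCouplingLimit` forces), but a kernel-checked `_false_without_connected` for
THIS crux needs (O1) — a two-plaquette covariance LOWER bound in the frozen phase — and a reflection-free
assembly; the sibling crux `TunedSequenceExists` (no free `c_k`) got its finite-group kill from upper
bounds alone (`Theorems/TunedSequenceExists/Negative/FiniteGroupFalse.lean`).  For a connected non-abelian
`G` the same place in a proof is where the lattice correlation length must DIVERGE in lattice units
along `β_k → ∞` (`ξ_k ≍ 1/a_k`, asymptotic freedom's `ξ ∼ e^{cβ}`, unproved); for `U(1)` (connected,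
abelian — excluded) it diverges for the wrong reason (massless Coulomb phase, `AbelianDeconfinementD4`)
and the GAP clauses fail instead. -/

end Summit.QuantumFields.YangMills.Cruxes.WeakCouplingHypercubicLimit.Disproof

end
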